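import Summits.NavierStokesRegularity.NavierStokesRegularity.Theorems.AdaptedFrequencyAdaptedFrequencyConvergesOfMildHullRigidity
import Summits.NavierStokesRegularity.NavierStokesRegularity.Theorems.AdaptedFrequencyAdaptedFrequencyConvergesOfRotatedHull
import Summits.NavierStokesRegularity.NavierStokesRegularity.Theorems.AdaptedFrequencyAdaptedFrequencyConvergesStubPinchedHullRecurrenceKernel
import Summits.NavierStokesRegularity.NavierStokesRegularity.Theorems.SymmetryModuliCountFarPastLedgerReduction
import Literature.Analysis.FluidPDE.HolderExtraction
import HarnessLib

/-!
# Crux `AdaptedFrequencyConverges` (stmt-NavierStokesRegularity-10493), line `birkhoff-recurrent-hull`: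
  stub `stub_pinchedHullRecurrence`, part 2 — the scaling orbit of a pinched pair and its limits

Helper file (`--supports` the crux item; stub-worker of lead prover-line-stmt-NavierStokesRegularity-10493-c4-0).

A PINCHED PAIR with constants `(C₀, c, C', c₁, c₂, C₁, C₂)` is a pair `(W, K)` of a unit-viscosity
Type-I ancient mild field `W ∈ IsTypeIAncientMild C₀` (KNSS Oseen gauge on `(−∞,0) × ℝ³`) and an
adapted backward kernel `K` of `∂ₜ + W·∇ − Δ` on `(−∞, 0)` with pole `(0, 0)`, squeezed between the
two Gaussians with constants `(c₁, c₂, C₁, C₂)`, whose rescaled adapted enstrophy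
`h̄(τ) = (−τ)²·adaptedEnstrophy W K τ` is pinched in `[c, C']` for all `τ < 0`.

* `pinchedPair_nsRescale` — the class is invariant under the parabolic rescaling
  `(W, K) ↦ (W_l, K_l)`, `W_l = nsRescale l W`, `K_l(t,x) = l³K(l²t, lx)`, `l > 0`: the Type-I
  constant (`isTypeIAncientMild_nsRescale`), the kernel clauses (`isAdaptedBackwardKernel_zoom`), the
  Gaussian constants (`gaussianProfile_zoom`) and `h̄` (`adaptedEnstrophy_zoom`: `h̄_l(τ) = h̄(l²τ)`)
  are scale-covariant.
* `pinchedPair_kernel_unique` — the kernel of a pinched pair is unique among Gaussian-comparable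
  adapted kernels (`adaptedKernel_unique_typeI`, kernel uniqueness for Type-I drifts).
* `pinchedPair_orbitLimit` — **every sequence of rescalings of ONE pinched pair subconverges,
  uniformly on every slab piece `[−(n+2), −1/(n+2)] × B̄(0, n+2)` in BOTH components, to a pinched
  pair with the same constants**: `C²_loc` extraction of the fields (KNSS 2009 Prop. 4.1 /
  Lemma 6.1: `exists_tendstoUniformlyOn_triple_of_typeI_oseenMild_windows`,
  `exists_tendsto_of_typeI_oseenMild_windows`), kernel stability (`kernelStability`,
  `isAdaptedBackwardKernel_of_limit`), pinching in the limit
  (`hullTransfer_tendsto_enstrophy_frequency`), and the upgrade of the pointwise convergence of the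
  kernels to uniform convergence on the pieces (`tendstoUniformlyOn_slabPiece_of_adaptedKernels`,
  part 1).  This is the sequential compactness of the orbit closure used by the Birkhoff argument.
-/

noncomputable section

-- the summit and its single problem share the name (D-0017 nested layout)
set_option linter.dupNamespace false

namespace Summit.NavierStokesRegularity.NavierStokesRegularity.Theorems.AdaptedFrequencyConverges.BirkhoffRecurrentHull

open scoped Topology
open Literature.Analysis Literature.Analysis.FluidPDE Set Filter MeasureTheory Function Metric
open Summit.NavierStokesRegularity.NavierStokesRegularity.Theorems.AdaptedFrequencyConverges.CloudFrameEffectiveTsai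

/-! ### Scale covariance of pinched pairs -/

/-- The parabolic dilation `r ↦ l² r` (`l ≠ 0`) preserves `(−∞, 0)`. [folklore] -/
theorem preimage_zoomTime_Iio_zero {l : ℝ} (hl : l ≠ 0) :
    (fun r : ℝ => 0 + l ^ 2 * r) ⁻¹' Iio (0:ℝ) = Iio 0 := by
  have hl2 : 0 < l ^ 2 := by positivity
  ext r
  simp only [mem_preimage, mem_Iio, zero_add]
  constructor
  · intro h; nlinarith
  · intro h; nlinarith

/-- The rescaled field as the tree's zoom about the origin: `nsRescale l W = l • W ∘ Φ_l`,
`Φ_l(s, y) = (l²s, l y)`. [folklore] -/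
theorem nsRescale_eq_smul_stPull (l : ℝ)
    (W : ℝ → (EuclideanSpace ℝ (Fin 3)) → (EuclideanSpace ℝ (Fin 3))) :
    nsRescale l W = l • stPull (l ^ 2) l (0:ℝ) (0 : EuclideanSpace ℝ (Fin 3)) W := by
  funext s y
  simp only [nsRescale_apply, Pi.smul_apply, stPull_apply, zero_add]

/-- The rescaled kernel as the tree's zoom about the origin: `K_l = l³ K ∘ Φ_l`. [folklore] -/
theorem kernelRescale_eq_smul_stPull (l : ℝ) (K : ℝ → (EuclideanSpace ℝ (Fin 3)) → ℝ) :
    (fun t x => l ^ 3 * K (l ^ 2 * t) (l • x)) =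
      (l ^ Module.finrank ℝ (EuclideanSpace ℝ (Fin 3))) •
        stPull (l ^ 2) l (0:ℝ) (0 : EuclideanSpace ℝ (Fin 3)) K := by
  funext s y
  rw [smul_stPull_kernel_apply, zero_add, zero_add, finrank_euclideanSpace_fin]

/-- **Gaussian bounds about `(0,0)` on `(−∞,0)` are covariant under `K ↦ K_l` with the SAME
constants.** [folklore] -/
theorem gaussian_bounds_kernelRescale {K : ℝ → (EuclideanSpace ℝ (Fin 3)) → ℝ} {c₁ c₂ C₁ C₂ : ℝ}
    (hKb : ∀ t ∈ Iio (0:ℝ), ∀ x,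
      c₁ * ((0:ℝ) - t) ^ (-(3:ℝ) / 2) *
          Real.exp (-(‖x - (0 : EuclideanSpace ℝ (Fin 3))‖ ^ 2) / (c₂ * ((0:ℝ) - t))) ≤ K t x ∧
        K t x ≤ C₁ * ((0:ℝ) - t) ^ (-(3:ℝ) / 2) *
          Real.exp (-(‖x - (0 : EuclideanSpace ℝ (Fin 3))‖ ^ 2) / (C₂ * ((0:ℝ) - t))))
    {l : ℝ} (hl : 0 < l) :
    ∀ t ∈ Iio (0:ℝ), ∀ x,
      c₁ * ((0:ℝ) - t) ^ (-(3:ℝ) / 2) *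
          Real.exp (-(‖x - (0 : EuclideanSpace ℝ (Fin 3))‖ ^ 2) / (c₂ * ((0:ℝ) - t))) ≤
          l ^ 3 * K (l ^ 2 * t) (l • x) ∧
        l ^ 3 * K (l ^ 2 * t) (l • x) ≤ C₁ * ((0:ℝ) - t) ^ (-(3:ℝ) / 2) *
          Real.exp (-(‖x - (0 : EuclideanSpace ℝ (Fin 3))‖ ^ 2) / (C₂ * ((0:ℝ) - t))) := by
  intro t ht y
  have hl2 : 0 < l ^ 2 := by positivity
  have ht' : l ^ 2 * t ∈ Iio (0:ℝ) := mul_neg_of_pos_of_neg hl2 ht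
  have ha : (0:ℝ) ≤ 0 - t := by simp only [mem_Iio] at ht; linarith
  obtain ⟨h1, h2⟩ := hKb _ ht' (l • y)
  have e1 := gaussianProfile_zoom (E := EuclideanSpace ℝ (Fin 3)) hl c₁ c₂ ha y
  have e2 := gaussianProfile_zoom (E := EuclideanSpace ℝ (Fin 3)) hl C₁ C₂ ha y
  rw [finrank_euclideanSpace_fin] at e1 e2
  simp only [Nat.cast_ofNat] at e1 e2
  rw [sub_zero] at h1 h2 ⊢
  have et : (0:ℝ) - l ^ 2 * t = l ^ 2 * (0 - t) := by ring
  rw [et] at h1 h2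
  rw [← e1, ← e2]
  have hl3 : 0 < l ^ 3 := by positivity
  exact ⟨mul_le_mul_of_nonneg_left h1 hl3.le, mul_le_mul_of_nonneg_left h2 hl3.le⟩

/-- **Pinched pairs are invariant under the parabolic rescaling** `(W, K) ↦ (W_l, K_l)`, `l > 0`,
with the SAME constants: Type-I class (`isTypeIAncientMild_nsRescale`), kernel clauses
(`isAdaptedBackwardKernel_zoom`), Gaussian bounds, and the pinching of
`h̄_l(τ) = (−τ)²·l⁴ H(l²τ) = h̄(l²τ)` (`adaptedEnstrophy_zoom`). [folklore] -/
theorem pinchedPair_nsRescale {C₀ c C' c₁ c₂ C₁ C₂ : ℝ}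
    {W : ℝ → (EuclideanSpace ℝ (Fin 3)) → (EuclideanSpace ℝ (Fin 3))}
    {K : ℝ → (EuclideanSpace ℝ (Fin 3)) → ℝ}
    (hW : IsTypeIAncientMild C₀ W) (hK : IsAdaptedBackwardKernel 1 W (Iio 0) 0 0 K)
    (hKb : ∀ t ∈ Iio (0:ℝ), ∀ x,
      c₁ * ((0:ℝ) - t) ^ (-(3:ℝ) / 2) *
          Real.exp (-(‖x - (0 : EuclideanSpace ℝ (Fin 3))‖ ^ 2) / (c₂ * ((0:ℝ) - t))) ≤ K t x ∧
        K t x ≤ C₁ * ((0:ℝ) - t) ^ (-(3:ℝ) / 2) *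
          Real.exp (-(‖x - (0 : EuclideanSpace ℝ (Fin 3))‖ ^ 2) / (C₂ * ((0:ℝ) - t))))
    (hpin : ∀ τ ∈ Iio (0:ℝ), c ≤ (-τ) ^ 2 * adaptedEnstrophy W K τ ∧
      (-τ) ^ 2 * adaptedEnstrophy W K τ ≤ C')
    {l : ℝ} (hl : 0 < l) :
    IsTypeIAncientMild C₀ (nsRescale l W) ∧
      IsAdaptedBackwardKernel 1 (nsRescale l W) (Iio 0) 0 0
        (fun t x => l ^ 3 * K (l ^ 2 * t) (l • x)) ∧
      (∀ t ∈ Iio (0:ℝ), ∀ x,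
        c₁ * ((0:ℝ) - t) ^ (-(3:ℝ) / 2) *
            Real.exp (-(‖x - (0 : EuclideanSpace ℝ (Fin 3))‖ ^ 2) / (c₂ * ((0:ℝ) - t))) ≤
            l ^ 3 * K (l ^ 2 * t) (l • x) ∧
          l ^ 3 * K (l ^ 2 * t) (l • x) ≤ C₁ * ((0:ℝ) - t) ^ (-(3:ℝ) / 2) *
            Real.exp (-(‖x - (0 : EuclideanSpace ℝ (Fin 3))‖ ^ 2) / (C₂ * ((0:ℝ) - t)))) ∧
      (∀ τ ∈ Iio (0:ℝ),
        c ≤ (-τ) ^ 2 * adaptedEnstrophy (nsRescale l W) (fun t x => l ^ 3 * K (l ^ 2 * t) (l • x)) τ ∧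
          (-τ) ^ 2 * adaptedEnstrophy (nsRescale l W) (fun t x => l ^ 3 * K (l ^ 2 * t) (l • x)) τ
            ≤ C') := by
  have hl2 : 0 < l ^ 2 := by positivity
  have eW := nsRescale_eq_smul_stPull l W
  have eK := kernelRescale_eq_smul_stPull l K
  refine ⟨isTypeIAncientMild_nsRescale hW hl, ?_, gaussian_bounds_kernelRescale hKb hl, ?_⟩
  · have h := isAdaptedBackwardKernel_zoom hK hl
    rw [preimage_zoomTime_Iio_zero hl.ne'] at h
    rw [eW, eK]
    exact h
  · intro τ hτ
    have hτ' : l ^ 2 * τ ∈ Iio (0:ℝ) := mul_neg_of_pos_of_neg hl2 hτ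
    have e3 : (fun t x => l ^ 3 * K (l ^ 2 * t) (l • x)) =
        (l ^ 3) • stPull (l ^ 2) l (0:ℝ) (0 : EuclideanSpace ℝ (Fin 3)) K := by
      rw [eK, finrank_euclideanSpace_fin]
    have hH : adaptedEnstrophy (nsRescale l W) (fun t x => l ^ 3 * K (l ^ 2 * t) (l • x)) τ =
        l ^ 4 * adaptedEnstrophy W K (l ^ 2 * τ) := by
      rw [eW, e3, adaptedEnstrophy_zoom W K 0 0 hl τ, zero_add]
    have e4 : (-τ) ^ 2 * (l ^ 4 * adaptedEnstrophy W K (l ^ 2 * τ)) =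
        (-(l ^ 2 * τ)) ^ 2 * adaptedEnstrophy W K (l ^ 2 * τ) := by ring
    rw [hH, e4]
    exact hpin _ hτ'

/-- **The kernel of a pinched pair is unique** among Gaussian-comparable adapted kernels of its
field (kernel uniqueness for Type-I drifts, `adaptedKernel_unique_typeI`; the field is jointly
smooth, divergence free and Type-I bounded on `(−∞, 0)`). [folklore] -/
theorem pinchedPair_kernel_unique {C₀ : ℝ}
    {W : ℝ → (EuclideanSpace ℝ (Fin 3)) → (EuclideanSpace ℝ (Fin 3))}
    {K : ℝ → (EuclideanSpace ℝ (Fin 3)) → ℝ}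
    (hW : IsTypeIAncientMild C₀ W) (hK : IsAdaptedBackwardKernel 1 W (Iio 0) 0 0 K)
    (hKc : IsGaussianComparable K (Iio 0) 0 0) :
    ∀ K' : ℝ → (EuclideanSpace ℝ (Fin 3)) → ℝ, IsAdaptedBackwardKernel 1 W (Iio 0) 0 0 K' →
      IsGaussianComparable K' (Iio 0) 0 0 → ∀ t ∈ Iio (0:ℝ), K' t = K t := by
  intro K' hK' hK'c
  refine adaptedKernel_unique_typeI 1 C₀ 0 (Iio 0) one_pos Subset.rfl (fun t _ => Ico_subset_Iio_self)
    W hW.contDiffOn (fun t ht => hW.isDivFree ht) (fun t ht x => ?_) 0 K' K hK' hK'c hK hKc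
  rw [zero_sub]
  exact hW.norm_le ht x

/-! ### Subsequential limits of the scaling orbit of a pinched pair -/

/-- A subsequence of a sequence converging uniformly on a set converges uniformly on it. [folklore] -/
theorem tendstoUniformlyOn_comp_of_tendsto {α β : Type*} [PseudoMetricSpace β] {F : ℕ → α → β}
    {f : α → β} {s : Set α} (h : TendstoUniformlyOn F f atTop s) {ψ : ℕ → ℕ}
    (hψ : Tendsto ψ atTop atTop) : TendstoUniformlyOn (fun j => F (ψ j)) f atTop s :=
  Metric.tendstoUniformlyOn_iff.2 fun ε hε => hψ.eventually (Metric.tendstoUniformlyOn_iff.1 h ε hε)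

/-- **Sequential compactness of the scaling orbit of a pinched pair.**  Let `(W, K)` be a pinched
pair with constants `(C₀, c, C', c₁, c₂, C₁, C₂)` and `l_k > 0` any scales.  Along a subsequence
`ψ` the rescaled pairs `(W_{l_{ψ j}}, K_{l_{ψ j}})` converge, UNIFORMLY ON EVERY SLAB PIECE
`[−(n+2), −1/(n+2)] × B̄(0, n+2)` in both components, to a pinched pair `(W', K')` with the same
constants.  Proof: the orbit stays in the class (`pinchedPair_nsRescale`); `C²_loc` extraction of
the fields on the pieces (`exists_tendstoUniformlyOn_triple_of_typeI_oseenMild_windows`) and the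
class of the limit with slice-wise convergence of two derivatives
(`exists_tendsto_of_typeI_oseenMild_windows`, KNSS 2009 Prop. 4.1 / Lemma 6.1; the two limits agree
pointwise); kernel stability along a further subsequence (`kernelStability`,
`isAdaptedBackwardKernel_of_limit`: the pointwise limit of the kernels is an adapted kernel of `W'`
between the same Gaussians); the pinching passes to the limit of the adapted enstrophies
(`hullTransfer_tendsto_enstrophy_frequency`, `h̄_k(τ) ∈ [c, C']` for every `k`); finally the
pointwise convergence of the kernels is uniform on the pieces by the joint equicontinuity of
adapted kernels of Type-I drifts (`tendstoUniformlyOn_slabPiece_of_adaptedKernels`).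
[cite: KochNadirashviliSereginSverak2009, Prop. 4.1 and Lemma 6.1 (arXiv:0709.3599 pp. 8, 11)] -/
theorem pinchedPair_orbitLimit {C₀ c C' c₁ c₂ C₁ C₂ : ℝ} (hC₀ : 0 ≤ C₀) (hc₁ : 0 < c₁)
    (hc₂ : 0 < c₂) (hC₁ : 0 < C₁) (hC₂ : 0 < C₂)
    {W : ℝ → (EuclideanSpace ℝ (Fin 3)) → (EuclideanSpace ℝ (Fin 3))}
    {K : ℝ → (EuclideanSpace ℝ (Fin 3)) → ℝ}
    (hW : IsTypeIAncientMild C₀ W) (hK : IsAdaptedBackwardKernel 1 W (Iio 0) 0 0 K)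
    (hKb : ∀ t ∈ Iio (0:ℝ), ∀ x,
      c₁ * ((0:ℝ) - t) ^ (-(3:ℝ) / 2) *
          Real.exp (-(‖x - (0 : EuclideanSpace ℝ (Fin 3))‖ ^ 2) / (c₂ * ((0:ℝ) - t))) ≤ K t x ∧
        K t x ≤ C₁ * ((0:ℝ) - t) ^ (-(3:ℝ) / 2) *
          Real.exp (-(‖x - (0 : EuclideanSpace ℝ (Fin 3))‖ ^ 2) / (C₂ * ((0:ℝ) - t))))
    (hpin : ∀ τ ∈ Iio (0:ℝ), c ≤ (-τ) ^ 2 * adaptedEnstrophy W K τ ∧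
      (-τ) ^ 2 * adaptedEnstrophy W K τ ≤ C')
    (l : ℕ → ℝ) (hl : ∀ k, 0 < l k) :
    ∃ ψ : ℕ → ℕ, StrictMono ψ ∧
      ∃ (W' : ℝ → (EuclideanSpace ℝ (Fin 3)) → (EuclideanSpace ℝ (Fin 3)))
        (K' : ℝ → (EuclideanSpace ℝ (Fin 3)) → ℝ),
        IsTypeIAncientMild C₀ W' ∧ IsAdaptedBackwardKernel 1 W' (Iio 0) 0 0 K' ∧
        (∀ t ∈ Iio (0:ℝ), ∀ x,
          c₁ * ((0:ℝ) - t) ^ (-(3:ℝ) / 2) *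
              Real.exp (-(‖x - (0 : EuclideanSpace ℝ (Fin 3))‖ ^ 2) / (c₂ * ((0:ℝ) - t))) ≤ K' t x ∧
            K' t x ≤ C₁ * ((0:ℝ) - t) ^ (-(3:ℝ) / 2) *
              Real.exp (-(‖x - (0 : EuclideanSpace ℝ (Fin 3))‖ ^ 2) / (C₂ * ((0:ℝ) - t)))) ∧
        (∀ τ ∈ Iio (0:ℝ), c ≤ (-τ) ^ 2 * adaptedEnstrophy W' K' τ ∧
          (-τ) ^ 2 * adaptedEnstrophy W' K' τ ≤ C') ∧
        (∀ n : ℕ, TendstoUniformlyOn (fun j z => nsRescale (l (ψ j)) W z.1 z.2) (fun z => W' z.1 z.2)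
          atTop (Icc (-((n : ℝ) + 2)) (-(1 / ((n : ℝ) + 2))) ×ˢ
            closedBall (0 : EuclideanSpace ℝ (Fin 3)) ((n : ℝ) + 2))) ∧
        (∀ n : ℕ, TendstoUniformlyOn
          (fun j z => (l (ψ j)) ^ 3 * K ((l (ψ j)) ^ 2 * z.1) ((l (ψ j)) • z.2)) (fun z => K' z.1 z.2)
          atTop (Icc (-((n : ℝ) + 2)) (-(1 / ((n : ℝ) + 2))) ×ˢ
            closedBall (0 : EuclideanSpace ℝ (Fin 3)) ((n : ℝ) + 2))) := by
  -- ## the orbit sequence stays in the class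
  set w : ℕ → ℝ → (EuclideanSpace ℝ (Fin 3)) → (EuclideanSpace ℝ (Fin 3)) :=
    fun k => nsRescale (l k) W with hw
  set g : ℕ → ℝ → (EuclideanSpace ℝ (Fin 3)) → ℝ :=
    fun k t x => (l k) ^ 3 * K ((l k) ^ 2 * t) ((l k) • x) with hg
  have hcls := fun k => pinchedPair_nsRescale hW hK hKb hpin (hl k)
  have hwk : ∀ k, IsTypeIAncientMild C₀ (w k) := fun k => (hcls k).1
  have hgk : ∀ k, IsAdaptedBackwardKernel 1 (w k) (Iio 0) 0 0 (g k) := fun k => (hcls k).2.1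
  have hgbk : ∀ k, ∀ t ∈ Iio (0:ℝ), ∀ x,
      c₁ * ((0:ℝ) - t) ^ (-(3:ℝ) / 2) *
          Real.exp (-(‖x - (0 : EuclideanSpace ℝ (Fin 3))‖ ^ 2) / (c₂ * ((0:ℝ) - t))) ≤ g k t x ∧
        g k t x ≤ C₁ * ((0:ℝ) - t) ^ (-(3:ℝ) / 2) *
          Real.exp (-(‖x - (0 : EuclideanSpace ℝ (Fin 3))‖ ^ 2) / (C₂ * ((0:ℝ) - t))) :=
    fun k => (hcls k).2.2.1
  have hpink : ∀ k, ∀ τ ∈ Iio (0:ℝ), c ≤ (-τ) ^ 2 * adaptedEnstrophy (w k) (g k) τ ∧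
      (-τ) ^ 2 * adaptedEnstrophy (w k) (g k) τ ≤ C' := fun k => (hcls k).2.2.2
  -- ## windows `[-(k+1), 0)` and the data on them
  set A : ℕ → ℝ := fun k => -((k : ℝ) + 1) with hA
  have hAt : Tendsto A atTop atBot :=
    tendsto_neg_atTop_atBot.comp (tendsto_atTop_add_const_right _ 1 tendsto_natCast_atTop_atTop)
  have hcw : ∀ k, ContinuousOn (uncurry (w k)) (Ioo (A k) 0 ×ˢ univ) := fun k =>
    (hwk k).continuousOn_uncurry.mono (prod_mono Ioo_subset_Iio_self Subset.rfl)
  have hdivw : ∀ k, ∀ t ∈ Ioo (A k) 0, IsWeaklyDivFree (w k t) := fun k t ht =>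
    (hwk k).isWeaklyDivFree ht.2
  have hmild : ∀ k, ∀ s t : ℝ, A k < s → s < t → t < 0 → ∀ x,
      w k t x = UnboundedOperators.heatExtension (w k s) (t - s) x -
        oseenDuhamel 1 s (w k) (w k) t x :=
    fun k s t _ hst ht x => (hwk k).mild_eq_heatExtension hst ht x
  have hIw : ∀ k, ∀ t ∈ Ioo (A k) 0, ∀ x, ‖w k t x‖ ≤ C₀ / Real.sqrt (-t) := fun k t ht x =>
    (hwk k).norm_le ht.2 x
  have hgw : ∀ k, IsAdaptedBackwardKernel 1 (w k) (Ico (A k) 0) 0 0 (g k) := fun k =>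
    (hgk k).mono Ico_subset_Iio_self (uniqueDiffOn_Ico _ _)
  have hgbw : ∀ k, ∀ t ∈ Ico (A k) 0, ∀ x,
      c₁ * ((0:ℝ) - t) ^ (-(3:ℝ) / 2) *
          Real.exp (-(‖x - (0 : EuclideanSpace ℝ (Fin 3))‖ ^ 2) / (c₂ * ((0:ℝ) - t))) ≤ g k t x ∧
        g k t x ≤ C₁ * ((0:ℝ) - t) ^ (-(3:ℝ) / 2) *
          Real.exp (-(‖x - (0 : EuclideanSpace ℝ (Fin 3))‖ ^ 2) / (C₂ * ((0:ℝ) - t))) :=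
    fun k t ht x => hgbk k t ht.2 x
  -- one pressure per orbit point
  have hpw : ∀ k, ∃ q : ℝ → (EuclideanSpace ℝ (Fin 3)) → ℝ,
      IsClassicalNSSolutionOn (Ico (A k) 0) 1 0 (w k) q := fun k => by
    obtain ⟨q, hq⟩ := exists_isClassicalNSSolutionOn_Iio_of_isTypeIAncientMild (hwk k)
    exact ⟨q, hq.mono Ico_subset_Iio_self (uniqueDiffOn_Ico _ _)⟩
  choose pw hclw using hpw
  -- ## Step 1: uniform convergence of the fields on the slab pieces
  obtain ⟨φ₁, hφ₁, W₁, G₁, H₁, hW₁, -, -⟩ :=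
    exists_tendstoUniformlyOn_triple_of_typeI_oseenMild_windows hC₀ hAt hcw hdivw hmild hIw
  have hφ₁t : Tendsto φ₁ atTop atTop := hφ₁.tendsto_atTop
  -- ## Step 2: the class of the limit, along a further subsequence
  obtain ⟨φ₂, hφ₂, W', hW', hlu0, hlu1, hlu2⟩ :=
    exists_tendsto_of_typeI_oseenMild_windows hC₀ (hAt.comp hφ₁t) (w := fun j => w (φ₁ j))
      (fun j => hcw (φ₁ j)) (fun j => hdivw (φ₁ j)) (fun j => hmild (φ₁ j)) (fun j => hIw (φ₁ j))
  have hφ₂t : Tendsto φ₂ atTop atTop := hφ₂.tendsto_atTop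
  set φ : ℕ → ℕ := fun j => φ₁ (φ₂ j) with hφdef
  have hφt : Tendsto φ atTop atTop := hφ₁t.comp hφ₂t
  -- the two limits agree on the open slab
  have hWW : ∀ t < 0, ∀ x, W₁ t x = W' t x := by
    intro t ht x
    have h1 : Tendsto (fun j => w (φ₁ (φ₂ j)) t x) atTop (𝓝 (W₁ t x)) :=
      (tendsto_of_tendstoUniformlyOn_slabPiece hW₁ ht x).comp hφ₂t
    have h2 : Tendsto (fun j => w (φ₁ (φ₂ j)) t x) atTop (𝓝 (W' t x)) :=
      tendsto_at_of_tendstoLocallyUniformly (hlu0 t ht) x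
    exact tendsto_nhds_unique h1 h2
  have hWu : ∀ n : ℕ, TendstoUniformlyOn (fun j z => w (φ j) z.1 z.2) (fun z => W' z.1 z.2) atTop
      (Icc (-((n : ℝ) + 2)) (-(1 / ((n : ℝ) + 2))) ×ˢ
        closedBall (0 : EuclideanSpace ℝ (Fin 3)) ((n : ℝ) + 2)) := fun n =>
    (tendstoUniformlyOn_comp_of_tendsto (hW₁ n) hφ₂t).congr_right fun z hz =>
      hWW z.1 (neg_of_mem_slabPiece hz) z.2
  -- ## Step 3: kernel stability along `φ ∘ ψ`
  obtain ⟨ψ, hψ, K', hK'c, hK'eq, hgK'⟩ := kernelStability C₀ c₁ c₂ C₁ C₂ (fun j => A (φ j))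
    (fun j => w (φ j)) (fun j => pw (φ j)) (fun j => g (φ j)) W' hC₀ hc₁ hc₂ hC₁ hC₂ (hAt.comp hφt)
    (fun j => hclw (φ j)) (fun j => hIw (φ j)) (fun j => hmild (φ j)) (fun j => hgw (φ j))
    (fun j => hgbw (φ j)) hW' hlu0 hlu1 hlu2
  have hψt : Tendsto ψ atTop atTop := hψ.tendsto_atTop
  have hφψt : Tendsto (fun j => φ (ψ j)) atTop atTop := hφt.comp hψt
  obtain ⟨hK'W, hK'b⟩ := isAdaptedBackwardKernel_of_limit (W := W') (K := K')
    (g := fun j => g (φ (ψ j))) (A := fun j => A (φ (ψ j))) (hAt.comp hφψt)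
    (fun j => (hgw _).integral_eq_one) (fun j t ht => ((hgw _).contDiff_slice ht).continuous) hc₁ hC₂
    (fun j => hgbw (φ (ψ j))) hK'c hK'eq hgK'
  -- ## Step 4: pinching in the limit
  obtain ⟨q', hW'cl⟩ := exists_isClassicalNSSolutionOn_Iio_of_isTypeIAncientMild hW'
  have hpin' : ∀ τ ∈ Iio (0:ℝ), c ≤ (-τ) ^ 2 * adaptedEnstrophy W' K' τ ∧
      (-τ) ^ 2 * adaptedEnstrophy W' K' τ ≤ C' := by
    intro τ hτ
    have hlim := (hullTransfer_tendsto_enstrophy_frequency hC₀ (hAt.comp hφψt)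
      (fun k => hclw (φ (ψ k))) (fun k => hmild (φ (ψ k))) (fun k => hIw (φ (ψ k)))
      (fun k => hgw (φ (ψ k))) hC₁.le hC₂ (fun k t ht x => (hgbw (φ (ψ k)) t ht x).2) hW'cl hK'W
      (fun t ht x => (tendsto_at_of_tendstoLocallyUniformly (hlu1 t ht) x).comp hψt)
      (fun t ht x => (tendsto_at_of_tendstoLocallyUniformly (hlu2 t ht) x).comp hψt) hgK' hτ).1
    have hH := hlim.const_mul ((-τ) ^ 2)
    exact ⟨ge_of_tendsto hH (Eventually.of_forall fun j => (hpink _ τ hτ).1),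
      le_of_tendsto hH (Eventually.of_forall fun j => (hpink _ τ hτ).2)⟩
  -- ## Step 5: the kernels converge uniformly on the pieces
  have hKu : ∀ n : ℕ, TendstoUniformlyOn (fun j z => g (φ (ψ j)) z.1 z.2) (fun z => K' z.1 z.2) atTop
      (Icc (-((n : ℝ) + 2)) (-(1 / ((n : ℝ) + 2))) ×ˢ
        closedBall (0 : EuclideanSpace ℝ (Fin 3)) ((n : ℝ) + 2)) := fun n =>
    tendstoUniformlyOn_slabPiece_of_adaptedKernels hC₀ hC₁ hC₂ (b := fun j => w (φ (ψ j)))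
      (g := fun j => g (φ (ψ j))) (fun j => (hwk _).contDiffOn) (fun j t ht => (hwk _).isDivFree ht)
      (fun j t ht x => (hwk _).norm_le ht x) (fun j => hgk _) (fun j t ht x => (hgbk _ t ht x).2)
      hgK' n
  -- ## conclusion
  refine ⟨fun j => φ (ψ j), fun a b hab => hφ₁ (hφ₂ (hψ hab)), W', K', hW', hK'W, hK'b, hpin',
    fun n => ?_, hKu⟩
  exact tendstoUniformlyOn_comp_of_tendsto (hWu n) hψt

/-- **Registered sub-goal `stub_pinchedHullRecurrence_orbitLimit`** (part 2 of the proof of STUB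
`stub_pinchedHullRecurrence`; the statement of `pinchedPair_orbitLimit` with the binders spelled
out): sequential compactness of the scaling orbit of a pinched pair, uniformly on the slab pieces in
both components. [cite: KochNadirashviliSereginSverak2009, Prop. 4.1 and Lemma 6.1 (arXiv:0709.3599 pp. 8, 11)] -/
theorem stub_pinchedHullRecurrence_orbitLimit : ∀ {C₀ c C' c₁ c₂ C₁ C₂ : ℝ}, 0 ≤ C₀ → 0 < c₁ → 0 < c₂ → 0 < C₁ → 0 < C₂ → ∀ {W : ℝ → EuclideanSpace ℝ (Fin 3) → EuclideanSpace ℝ (Fin 3)} {K : ℝ → EuclideanSpace ℝ (Fin 3) → ℝ}, Literature.Analysis.FluidPDE.IsTypeIAncientMild C₀ W → Literature.Analysis.FluidPDE.IsAdaptedBackwardKernel 1 W (Set.Iio 0) 0 0 K → (∀ t ∈ Set.Iio (0:ℝ), ∀ x, c₁ * ((0:ℝ) - t) ^ (-(3:ℝ) / 2) * Real.exp (-(‖x - (0 : EuclideanSpace ℝ (Fin 3))‖ ^ 2) / (c₂ * ((0:ℝ) - t))) ≤ K t x ∧ K t x ≤ C₁ * ((0:ℝ) - t) ^ (-(3:ℝ)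 / 2) * Real.exp (-(‖x - (0 : EuclideanSpace ℝ (Fin 3))‖ ^ 2) / (C₂ * ((0:ℝ) - t)))) → (∀ τ ∈ Set.Iio (0:ℝ), c ≤ (-τ) ^ 2 * Literature.Analysis.FluidPDE.adaptedEnstrophy W K τ ∧ (-τ) ^ 2 * Literature.Analysis.FluidPDE.adaptedEnstrophy W K τ ≤ C') → ∀ (l : ℕ → ℝ), (∀ k, 0 < l k) → ∃ ψ : ℕ → ℕ, StrictMono ψ ∧ ∃ (W' : ℝ → EuclideanSpace ℝ (Fin 3) → EuclideanSpace ℝ (Fin 3)) (K' : ℝ → EuclideanSpace ℝ (Fin 3) → ℝ), Literature.Analysis.FluidPDE.IsTypeIAncientMild C₀ W' ∧ Literature.Analysis.FluidPDE.IsAdaptedBackwardKernel 1 W' (Set.Iio 0) 0 0 K' ∧ (∀ t ∈ Set.Iio (0:ℝ), ∀ x, c₁ * ((0:ℝ) - t) ^ (-(3:ℝ) / 2) * Real.exp (-(‖x - (0 : EuclideanSpace ℝ (Fin 3))‖ ^ 2) / (c₂ * ((0:ℝ) - t))) ≤ K' t x ∧ K' t x ≤ C₁ * ((0:ℝ) -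 t) ^ (-(3:ℝ) / 2) * Real.exp (-(‖x - (0 : EuclideanSpace ℝ (Fin 3))‖ ^ 2) / (C₂ * ((0:ℝ) - t)))) ∧ (∀ τ ∈ Set.Iio (0:ℝ), c ≤ (-τ) ^ 2 * Literature.Analysis.FluidPDE.adaptedEnstrophy W' K' τ ∧ (-τ) ^ 2 * Literature.Analysis.FluidPDE.adaptedEnstrophy W' K' τ ≤ C') ∧ (∀ n : ℕ, TendstoUniformlyOn (fun j z => Literature.Analysis.FluidPDE.nsRescale (l (ψ j)) W z.1 z.2) (fun z => W' z.1 z.2) Filter.atTop (Set.Icc (-((n : ℝ) + 2)) (-(1 / ((n : ℝ) + 2))) ×ˢ Metric.closedBall (0 : EuclideanSpace ℝ (Fin 3)) ((n : ℝ) + 2))) ∧ (∀ n : ℕ, TendstoUniformlyOn (fun j z => (l (ψ j)) ^ 3 * K ((l (ψ j)) ^ 2 * z.1) ((l (ψ j)) • z.2)) (fun z => K' z.1 z.2) Filter.atTop (Set.Icc (-((n : ℝ) + 2)) (-(1 / ((n : ℝ) + 2))) ×ˢ Metric.closedBall (0 : EuclideanSpace ℝ (Fin 3)) ((n : ℝ)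 + 2))) :=
  fun hC₀ hc₁ hc₂ hC₁ hC₂ _ _ hW hK hKb hpin l hl =>
    pinchedPair_orbitLimit hC₀ hc₁ hc₂ hC₁ hC₂ hW hK hKb hpin l hl

end Summit.NavierStokesRegularity.NavierStokesRegularity.Theorems.AdaptedFrequencyConverges.BirkhoffRecurrentHull

end
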